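import Mathlib
import Summits.NavierStokesRegularity.NavierStokesRegularity.Theorems.EulerZoomLiouvillePowerGaugeEulerLiouvilleCasimirHaulRaceKit
import HarnessLib

/-!
# Crux `EulerZoomLiouville.PowerGaugeEulerLiouville` (stmt-NavierStokesRegularity-19832), width sub-line `casimir_haul` (ns-idea-11 g10/g11),
# H4 `stub_haulRace` — THE HAUL RACE as a TREE theorem of its two sub-stubs H4a/H4c (port of the line's `haulRace_of`, REV2/REV3)

Seat ns-ezl-w3 g8 (`--supports stmt-NavierStokesRegularity-19832 --as helper`); proof by ns-idea-11 g11 in the Cruxes workfile (not importable by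
Theorems), ported over `…CasimirHaulRaceKit`: ★ `CasimirHaul.haulRace_filler : <Sig.stub_haulTravel body> → <Sig.stub_haulBook body> →
<Sig.stub_haulRace body>` with every line-local definition (`InClass`, `IsSlabBoundedSwirlFree`, `IsLedgerFlow`, `HasLedgerFlows`, `ledgerBlob`,
`solidCyl`, `haulShell`, `axisMoment`, `HaulingInequality`) δ-unfolded VERBATIM from `Lines/casimir_haul.lean` (31279a74fac8e2c7).  The race: blob of
positive volume (`exists_ledgerBlob_pos`), scale `b`, window `(τ − b², τ)`, BANISHMENT (`exists_banished`), TRAVEL (H4a) + BOOKKEEPING (H4c) ⇒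
`|S| ≤ |S|/2 + |S|/4`, absurd.  Line: `theorem stub_haulRace : Sig.stub_haulRace := CasimirHaul.haulRace_filler stub_haulTravel stub_haulBook`.

HONEST FRAMING: composition for a width sub-line of the MODEL-lattice crux class (its H3/H4a remain stubs; H6 = the crux's open complement);
nothing about the crux E (19832 OPEN) or NS regularity; not E. [cite: CaffarelliKohnNirenberg1982, §2; MajdaBertozziCUP2002, §2.3.3]
-/

noncomputable section

set_option linter.dupNamespace false

open MeasureTheory Set Filter Topology Metric Function
open scoped NNReal ENNReal ContDiff Topology

namespace Summit.NavierStokesRegularity.NavierStokesRegularity.Theorems.PowerGaugeEulerLiouville.CasimirHaul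

open Literature.Analysis Literature.Analysis.FluidPDE
open Summit.NavierStokesRegularity.NavierStokesRegularity.Theorems.PowerGaugeEulerLiouville

/-- ★ **H4 `stub_haulRace` from H4a + H4c** (= `haulRace_of` of `Lines/casimir_haul.lean`, statement δ-unfolded VERBATIM): given the hauling
inequality, a member of Seregin's class (ANY `ρ > 0`) in the haulable stratum with ledger flows has IRROTATIONAL slices.
(ns-idea-11 g11's proof, ported.) [cite: CaffarelliKohnNirenberg1982, §2; MajdaBertozziCUP2002, §2.3.3] -/
theorem haulRace_filler :
    (∃ K : ℝ, 0 < K ∧ ∀ b : ℝ, 1 ≤ b →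
    ∀ (u : ℝ → (EuclideanSpace ℝ (Fin 3)) → (EuclideanSpace ℝ (Fin 3))) (p : ℝ → (EuclideanSpace ℝ (Fin 3)) → ℝ), (Literature.Analysis.FluidPDE.IsClassicalEulerSolutionOn (Set.Iio 0) 0 u p ∧
    (∀ τ : ℝ, τ < 0 → Literature.Analysis.FluidPDE.IsAxisymmetric (u τ) ∧ Literature.Analysis.FluidPDE.HasNoSwirl (u τ)) ∧
    (∀ T₁ T₀ : ℝ, T₁ ≤ T₀ → T₀ < 0 → ∃ B : ℝ, ∀ τ ∈ Set.Icc T₁ T₀, ∀ x : (EuclideanSpace ℝ (Fin 3)), ‖u τ x‖ ≤ B)) →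
      ∀ lam t₁ t₀ : ℝ, t₁ < t₀ → t₀ < 0 →
        ∀ S : Set (EuclideanSpace ℝ (Fin 3)), MeasurableSet S → S ⊆ Metric.closedBall (0 : (EuclideanSpace ℝ (Fin 3))) (b / 4) →
          ∀ X : ℝ → (EuclideanSpace ℝ (Fin 3)) → (EuclideanSpace ℝ (Fin 3)), (Continuous (fun q : ℝ × (EuclideanSpace ℝ (Fin 3)) => X q.1 q.2) ∧
    (∀ x ∈ S, X t₀ x = x) ∧
    (∀ s ∈ Set.Icc t₁ t₀, ∀ x ∈ S, HasDerivWithinAt (fun σ : ℝ => X σ x) (u s (X s x)) (Set.Icc t₁ t₀) s) ∧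
    (∀ s ∈ Set.Icc t₁ t₀, Set.InjOn (X s) S) ∧
    (∀ s ∈ Set.Icc t₁ t₀, MeasurableSet (X s '' S) ∧ volume (X s '' S) = volume S) ∧
    (∀ s ∈ Set.Icc t₁ t₀, ∀ g : (EuclideanSpace ℝ (Fin 3)) → ℝ≥0∞, Measurable g → ∫⁻ x in X s '' S, g x = ∫⁻ x in S, g (X s x)) ∧
    (∃ R : ℝ, ∀ s ∈ Set.Icc t₁ t₀, X s '' S ⊆ Metric.ball (0 : (EuclideanSpace ℝ (Fin 3))) R) ∧
    (∀ s ∈ Set.Icc t₁ t₀, ∀ x ∈ S,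
      lam * Literature.Analysis.FluidPDE.cylRadius (X s x) ≤ ‖Literature.Analysis.FluidPDE.curl (u s) (X s x)‖)) →
            ∃ w : ℝ → ℝ, Measurable w ∧ (∀ z : ℝ, |w z| ≤ 1) ∧
              ∀ s₁ ∈ Set.Ioo t₁ t₀,
                volume S ≤ volume (X s₁ '' S ∩ Metric.ball (0 : (EuclideanSpace ℝ (Fin 3))) (3 * b)) +
                  ENNReal.ofReal (K / b) *
                    ((∫⁻ s in Set.Ioo t₁ t₀,
                        ‖∫ x in X s '' S ∩ ({x : (EuclideanSpace ℝ (Fin 3)) | Literature.Analysis.FluidPDE.cylRadius x < 2 * b ∧ |x 2| < b}), w (x 2) * (u s x) 2‖ₑ) +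
                      ∫⁻ s in Set.Ioo t₁ t₀, ∫⁻ x in X s '' S ∩ ({x : (EuclideanSpace ℝ (Fin 3)) | x ∈ Metric.ball (0 : (EuclideanSpace ℝ (Fin 3))) (3 * b) ∧ b ≤ Literature.Analysis.FluidPDE.cylRadius x}), ‖u s x‖ₑ)) →
    ((∃ C : ℝ, 0 < C ∧ ∀ b : ℝ, 1 ≤ b → ∀ v : (EuclideanSpace ℝ (Fin 3)) → (EuclideanSpace ℝ (Fin 3)), ContDiff ℝ 1 v →
    ∀ w : ℝ → ℝ, Measurable w → (∀ z : ℝ, |w z| ≤ 1) →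
      ∀ A : Set (EuclideanSpace ℝ (Fin 3)), MeasurableSet A → A ⊆ ({x : (EuclideanSpace ℝ (Fin 3)) | Literature.Analysis.FluidPDE.cylRadius x < 2 * b ∧ |x 2| < b}) →
        |∫ x in A, w (x 2) * (v x) 2| ≤
          C * Real.sqrt (∫ x in ({x : (EuclideanSpace ℝ (Fin 3)) | Literature.Analysis.FluidPDE.cylRadius x < 2 * b ∧ |x 2| < b}), ‖fderiv ℝ v x‖ ^ 2) *
              Real.sqrt ((∫ x in A, Literature.Analysis.FluidPDE.cylRadius x ^ 2) * (1 + Real.log b + max 0 (Real.log (b / (∫ x in A, Literature.Analysis.FluidPDE.cylRadius x ^ 2))))) +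
            C * Real.sqrt ((∫ x in A, Literature.Analysis.FluidPDE.cylRadius x ^ 2) / b ^ 2) * Real.sqrt (∫ x in ({x : (EuclideanSpace ℝ (Fin 3)) | Literature.Analysis.FluidPDE.cylRadius x < 2 * b ∧ |x 2| < b}), ‖v x‖ ^ 2)) → ∀ ρ : ℝ, 0 < ρ → ∃ K : ℝ, 0 < K ∧
    ∀ (u : ℝ → (EuclideanSpace ℝ (Fin 3)) → (EuclideanSpace ℝ (Fin 3))) (p : ℝ → (EuclideanSpace ℝ (Fin 3)) → ℝ) (H : ℝ → (EuclideanSpace ℝ (Fin 3)) → (EuclideanSpace ℝ (Fin 3)) →L[ℝ] (EuclideanSpace ℝ (Fin 3))) (c : ℝ≥0),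
      (Literature.Analysis.FluidPDE.IsSuitableWeakSolutionOn
      (Literature.Analysis.FluidPDE.slab (EuclideanSpace ℝ (Fin 3)) (Set.Iio 0) isOpen_Iio) 0 0 u p ∧
    Literature.Analysis.FluidPDE.HasWeakSpatialGradientOn
      (Literature.Analysis.FluidPDE.slab (EuclideanSpace ℝ (Fin 3)) (Set.Iio 0) isOpen_Iio) u H ∧
    (∀ a : ℝ, 0 < a →
      ENNReal.ofReal (a ^ (2 * ρ)) * Literature.Analysis.FluidPDE.cknA a (0 : ℝ × (EuclideanSpace ℝ (Fin 3))) u +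
          ENNReal.ofReal (a ^ ρ) * Literature.Analysis.FluidPDE.cknE a (0 : ℝ × (EuclideanSpace ℝ (Fin 3))) H +
        ENNReal.ofReal (a ^ (2 * ρ)) * Literature.Analysis.FluidPDE.cknD a (0 : ℝ × (EuclideanSpace ℝ (Fin 3))) p ≤ (c : ℝ≥0∞))) → (Literature.Analysis.FluidPDE.IsClassicalEulerSolutionOn (Set.Iio 0) 0 u p ∧
    (∀ τ : ℝ, τ < 0 → Literature.Analysis.FluidPDE.IsAxisymmetric (u τ) ∧ Literature.Analysis.FluidPDE.HasNoSwirl (u τ)) ∧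
    (∀ T₁ T₀ : ℝ, T₁ ≤ T₀ → T₀ < 0 → ∃ B : ℝ, ∀ τ ∈ Set.Icc T₁ T₀, ∀ x : (EuclideanSpace ℝ (Fin 3)), ‖u τ x‖ ≤ B)) →
        ∀ lam : ℝ, 0 < lam → lam ≤ 1 → ∀ b : ℝ, 1 ≤ b →
          ∀ t₁ t₀ : ℝ, -(3 * b) ^ 2 ≤ t₁ → t₀ ≤ 0 → t₀ - t₁ ≤ b ^ 2 →
            ∀ (S : Set (EuclideanSpace ℝ (Fin 3))) (X : ℝ → (EuclideanSpace ℝ (Fin 3)) → (EuclideanSpace ℝ (Fin 3))), (Continuous (fun q : ℝ × (EuclideanSpace ℝ (Fin 3)) => X q.1 q.2) ∧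
    (∀ x ∈ S, X t₀ x = x) ∧
    (∀ s ∈ Set.Icc t₁ t₀, ∀ x ∈ S, HasDerivWithinAt (fun σ : ℝ => X σ x) (u s (X s x)) (Set.Icc t₁ t₀) s) ∧
    (∀ s ∈ Set.Icc t₁ t₀, Set.InjOn (X s) S) ∧
    (∀ s ∈ Set.Icc t₁ t₀, MeasurableSet (X s '' S) ∧ volume (X s '' S) = volume S) ∧
    (∀ s ∈ Set.Icc t₁ t₀, ∀ g : (EuclideanSpace ℝ (Fin 3)) → ℝ≥0∞, Measurable g → ∫⁻ x in X s '' S, g x = ∫⁻ x in S, g (X s x)) ∧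
    (∃ R : ℝ, ∀ s ∈ Set.Icc t₁ t₀, X s '' S ⊆ Metric.ball (0 : (EuclideanSpace ℝ (Fin 3))) R) ∧
    (∀ s ∈ Set.Icc t₁ t₀, ∀ x ∈ S,
      lam * Literature.Analysis.FluidPDE.cylRadius (X s x) ≤ ‖Literature.Analysis.FluidPDE.curl (u s) (X s x)‖)) →
              ∀ w : ℝ → ℝ, Measurable w → (∀ z : ℝ, |w z| ≤ 1) →
                (∫⁻ s in Set.Ioo t₁ t₀, ‖∫ x in X s '' S ∩ ({x : (EuclideanSpace ℝ (Fin 3)) | Literature.Analysis.FluidPDE.cylRadius x < 2 * b ∧ |x 2| < b}), w (x 2) * (u s x) 2‖ₑ) +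
                    ∫⁻ s in Set.Ioo t₁ t₀, ∫⁻ x in X s '' S ∩ ({x : (EuclideanSpace ℝ (Fin 3)) | x ∈ Metric.ball (0 : (EuclideanSpace ℝ (Fin 3))) (3 * b) ∧ b ≤ Literature.Analysis.FluidPDE.cylRadius x}), ‖u s x‖ₑ ≤
                  ENNReal.ofReal (K * ((c : ℝ) + 1) * b ^ (1 - min ρ 1 / 2) / lam)) →
    (∃ C : ℝ, 0 < C ∧ ∀ b : ℝ, 1 ≤ b → ∀ v : (EuclideanSpace ℝ (Fin 3)) → (EuclideanSpace ℝ (Fin 3)), ContDiff ℝ 1 v →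
    ∀ w : ℝ → ℝ, Measurable w → (∀ z : ℝ, |w z| ≤ 1) →
      ∀ A : Set (EuclideanSpace ℝ (Fin 3)), MeasurableSet A → A ⊆ ({x : (EuclideanSpace ℝ (Fin 3)) | Literature.Analysis.FluidPDE.cylRadius x < 2 * b ∧ |x 2| < b}) →
        |∫ x in A, w (x 2) * (v x) 2| ≤
          C * Real.sqrt (∫ x in ({x : (EuclideanSpace ℝ (Fin 3)) | Literature.Analysis.FluidPDE.cylRadius x < 2 * b ∧ |x 2| < b}), ‖fderiv ℝ v x‖ ^ 2) *
              Real.sqrt ((∫ x in A, Literature.Analysis.FluidPDE.cylRadius x ^ 2) * (1 + Real.log b + max 0 (Real.log (b / (∫ x in A, Literature.Analysis.FluidPDE.cylRadius x ^ 2))))) +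
            C * Real.sqrt ((∫ x in A, Literature.Analysis.FluidPDE.cylRadius x ^ 2) / b ^ 2) * Real.sqrt (∫ x in ({x : (EuclideanSpace ℝ (Fin 3)) | Literature.Analysis.FluidPDE.cylRadius x < 2 * b ∧ |x 2| < b}), ‖v x‖ ^ 2)) →
    ∀ ρ : ℝ, 0 < ρ → ∀ (u : ℝ → (EuclideanSpace ℝ (Fin 3)) → (EuclideanSpace ℝ (Fin 3))) (p : ℝ → (EuclideanSpace ℝ (Fin 3)) → ℝ) (H : ℝ → (EuclideanSpace ℝ (Fin 3)) → (EuclideanSpace ℝ (Fin 3)) →L[ℝ] (EuclideanSpace ℝ (Fin 3))) (c : ℝ≥0),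
      (Literature.Analysis.FluidPDE.IsSuitableWeakSolutionOn
      (Literature.Analysis.FluidPDE.slab (EuclideanSpace ℝ (Fin 3)) (Set.Iio 0) isOpen_Iio) 0 0 u p ∧
    Literature.Analysis.FluidPDE.HasWeakSpatialGradientOn
      (Literature.Analysis.FluidPDE.slab (EuclideanSpace ℝ (Fin 3)) (Set.Iio 0) isOpen_Iio) u H ∧
    (∀ a : ℝ, 0 < a →
      ENNReal.ofReal (a ^ (2 * ρ)) * Literature.Analysis.FluidPDE.cknA a (0 : ℝ × (EuclideanSpace ℝ (Fin 3))) u +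
          ENNReal.ofReal (a ^ ρ) * Literature.Analysis.FluidPDE.cknE a (0 : ℝ × (EuclideanSpace ℝ (Fin 3))) H +
        ENNReal.ofReal (a ^ (2 * ρ)) * Literature.Analysis.FluidPDE.cknD a (0 : ℝ × (EuclideanSpace ℝ (Fin 3))) p ≤ (c : ℝ≥0∞))) → (Literature.Analysis.FluidPDE.IsClassicalEulerSolutionOn (Set.Iio 0) 0 u p ∧
    (∀ τ : ℝ, τ < 0 → Literature.Analysis.FluidPDE.IsAxisymmetric (u τ) ∧ Literature.Analysis.FluidPDE.HasNoSwirl (u τ)) ∧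
    (∀ T₁ T₀ : ℝ, T₁ ≤ T₀ → T₀ < 0 → ∃ B : ℝ, ∀ τ ∈ Set.Icc T₁ T₀, ∀ x : (EuclideanSpace ℝ (Fin 3)), ‖u τ x‖ ≤ B)) → (∀ t₀ : ℝ, t₀ < 0 → ∀ t₁ : ℝ, t₁ < t₀ → ∀ lam R₀ : ℝ, 0 < lam → 0 < R₀ →
    ∃ X : ℝ → (EuclideanSpace ℝ (Fin 3)) → (EuclideanSpace ℝ (Fin 3)), (Continuous (fun q : ℝ × (EuclideanSpace ℝ (Fin 3)) => X q.1 q.2) ∧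
    (∀ x ∈ ({x : (EuclideanSpace ℝ (Fin 3)) | x ∈ Metric.closedBall (0 : (EuclideanSpace ℝ (Fin 3))) R₀ ∧
    lam * Literature.Analysis.FluidPDE.cylRadius x ≤ ‖Literature.Analysis.FluidPDE.curl (u t₀) x‖}), X t₀ x = x) ∧
    (∀ s ∈ Set.Icc t₁ t₀, ∀ x ∈ ({x : (EuclideanSpace ℝ (Fin 3)) | x ∈ Metric.closedBall (0 : (EuclideanSpace ℝ (Fin 3))) R₀ ∧
    lam * Literature.Analysis.FluidPDE.cylRadius x ≤ ‖Literature.Analysis.FluidPDE.curl (u t₀) x‖}), HasDerivWithinAt (fun σ : ℝ => X σ x) (u s (X s x)) (Set.Icc t₁ t₀) s) ∧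
    (∀ s ∈ Set.Icc t₁ t₀, Set.InjOn (X s) ({x : (EuclideanSpace ℝ (Fin 3)) | x ∈ Metric.closedBall (0 : (EuclideanSpace ℝ (Fin 3))) R₀ ∧
    lam * Literature.Analysis.FluidPDE.cylRadius x ≤ ‖Literature.Analysis.FluidPDE.curl (u t₀) x‖})) ∧
    (∀ s ∈ Set.Icc t₁ t₀, MeasurableSet (X s '' ({x : (EuclideanSpace ℝ (Fin 3)) | x ∈ Metric.closedBall (0 : (EuclideanSpace ℝ (Fin 3))) R₀ ∧
    lam * Literature.Analysis.FluidPDE.cylRadius x ≤ ‖Literature.Analysis.FluidPDE.curl (u t₀) x‖})) ∧ volume (X s '' ({x : (EuclideanSpace ℝ (Fin 3)) | x ∈ Metric.closedBall (0 : (EuclideanSpace ℝ (Fin 3))) R₀ ∧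
    lam * Literature.Analysis.FluidPDE.cylRadius x ≤ ‖Literature.Analysis.FluidPDE.curl (u t₀) x‖})) = volume ({x : (EuclideanSpace ℝ (Fin 3)) | x ∈ Metric.closedBall (0 : (EuclideanSpace ℝ (Fin 3))) R₀ ∧
    lam * Literature.Analysis.FluidPDE.cylRadius x ≤ ‖Literature.Analysis.FluidPDE.curl (u t₀) x‖})) ∧
    (∀ s ∈ Set.Icc t₁ t₀, ∀ g : (EuclideanSpace ℝ (Fin 3)) → ℝ≥0∞, Measurable g → ∫⁻ x in X s '' ({x : (EuclideanSpace ℝ (Fin 3)) | x ∈ Metric.closedBall (0 : (EuclideanSpace ℝ (Fin 3))) R₀ ∧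
    lam * Literature.Analysis.FluidPDE.cylRadius x ≤ ‖Literature.Analysis.FluidPDE.curl (u t₀) x‖}), g x = ∫⁻ x in ({x : (EuclideanSpace ℝ (Fin 3)) | x ∈ Metric.closedBall (0 : (EuclideanSpace ℝ (Fin 3))) R₀ ∧
    lam * Literature.Analysis.FluidPDE.cylRadius x ≤ ‖Literature.Analysis.FluidPDE.curl (u t₀) x‖}), g (X s x)) ∧
    (∃ R : ℝ, ∀ s ∈ Set.Icc t₁ t₀, X s '' ({x : (EuclideanSpace ℝ (Fin 3)) | x ∈ Metric.closedBall (0 : (EuclideanSpace ℝ (Fin 3))) R₀ ∧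
    lam * Literature.Analysis.FluidPDE.cylRadius x ≤ ‖Literature.Analysis.FluidPDE.curl (u t₀) x‖}) ⊆ Metric.ball (0 : (EuclideanSpace ℝ (Fin 3))) R) ∧
    (∀ s ∈ Set.Icc t₁ t₀, ∀ x ∈ ({x : (EuclideanSpace ℝ (Fin 3)) | x ∈ Metric.closedBall (0 : (EuclideanSpace ℝ (Fin 3))) R₀ ∧
    lam * Literature.Analysis.FluidPDE.cylRadius x ≤ ‖Literature.Analysis.FluidPDE.curl (u t₀) x‖}),
      lam * Literature.Analysis.FluidPDE.cylRadius (X s x) ≤ ‖Literature.Analysis.FluidPDE.curl (u s) (X s x)‖))) →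
        ∀ τ : ℝ, τ < 0 → ∀ x : (EuclideanSpace ℝ (Fin 3)), Literature.Analysis.FluidPDE.curl (u τ) x = 0 := by
  intro hT hB hHI ρ hρ u p H c hcls hstr hfl τ hτ x₀
  by_contra hne
  obtain ⟨Ka, hKa, hTrav⟩ := hT
  obtain ⟨Kb, hKb, hBook⟩ := hB hHI ρ hρ
  have hcl : IsClassicalEulerSolutionOn (Set.Iio 0) 0 u p := hstr.1
  have hH := hcls.2.1
  have hgauge := hcls.2.2
  obtain ⟨lam, R₀, hlam, hlam1, hR₀, hvol⟩ := exists_ledgerBlob_pos hcl hτ hne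
  obtain ⟨S, hS⟩ : ∃ S : Set (EuclideanSpace ℝ (Fin 3)), S = {x : EuclideanSpace ℝ (Fin 3) | x ∈ Metric.closedBall (0 : EuclideanSpace ℝ (Fin 3)) R₀ ∧
      lam * cylRadius x ≤ ‖curl (u τ) x‖} := ⟨_, rfl⟩
  rw [← hS] at hvol
  have hKc : Continuous (curl (u τ)) := by
    have hv : ContDiff ℝ 1 (u τ) := (hcl.contDiff_velocity (show τ ∈ Set.Iio 0 from hτ)).of_le (by norm_cast)
    rw [curl_eq_curlCLM_comp]
    exact curlCLM.continuous.comp (hv.continuous_fderiv one_ne_zero)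
  have hSmeas : MeasurableSet S := by
    rw [hS]
    exact (isClosed_closedBall.inter (isClosed_le (continuous_const.mul continuous_cylRadius) hKc.norm)).measurableSet
  have hSsub : S ⊆ Metric.closedBall (0 : EuclideanSpace ℝ (Fin 3)) R₀ := by rw [hS]; exact fun _ hx => hx.1
  have hSfin : volume S < ⊤ := (measure_mono hSsub).trans_lt measure_closedBall_lt_top
  set v : ℝ := (volume S).toReal with hvdef
  have hv : 0 < v := ENNReal.toReal_pos hvol.ne' hSfin.ne
  set ρ₁ : ℝ := min ρ 1 with hρ₁def
  have hρ₁ : 0 < ρ₁ := lt_min hρ one_pos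
  have hρ₁1 : ρ₁ ≤ 1 := min_le_right _ _
  -- the scale `b`
  set Q₁ : ℝ := 18432 * ((c : ℝ) + 1) / (lam ^ 2 * v ^ 2) with hQ₁def
  set Q₂ : ℝ := 4 * Ka * Kb * ((c : ℝ) + 1) / (lam * v) with hQ₂def
  have hQ₁ : 0 < Q₁ := by positivity
  have hQ₂ : 0 < Q₂ := by positivity
  set b : ℝ := max (max 1 (max (4 * R₀) (-τ))) (max (Q₁ ^ ρ₁⁻¹ + 1) (Q₂ ^ (ρ₁ / 2)⁻¹ + 1)) with hbdef
  have hb1 : 1 ≤ b := le_trans (le_max_left _ _) (le_max_left _ _)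
  have hb0 : 0 < b := by linarith
  have hbR : 4 * R₀ ≤ b := le_trans (le_trans (le_max_left _ _) (le_max_right _ _)) (le_max_left _ _)
  have hbτ : -τ ≤ b := le_trans (le_trans (le_max_right _ _) (le_max_right _ _)) (le_max_left _ _)
  have hbQ₁ : Q₁ ^ ρ₁⁻¹ < b :=
    lt_of_lt_of_le (by linarith) (le_trans (le_max_left _ _) (le_max_right _ _))
  have hbQ₂ : Q₂ ^ (ρ₁ / 2)⁻¹ < b :=
    lt_of_lt_of_le (by linarith) (le_trans (le_max_right _ _) (le_max_right _ _))
  have hQ₁b : Q₁ < b ^ ρ₁ := by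
    calc Q₁ = (Q₁ ^ ρ₁⁻¹) ^ ρ₁ := (Real.rpow_inv_rpow hQ₁.le hρ₁.ne').symm
      _ < b ^ ρ₁ := Real.rpow_lt_rpow (by positivity) hbQ₁ hρ₁
  have hQ₂b : Q₂ < b ^ (ρ₁ / 2) := by
    calc Q₂ = (Q₂ ^ (ρ₁ / 2)⁻¹) ^ (ρ₁ / 2) := (Real.rpow_inv_rpow hQ₂.le (by positivity)).symm
      _ < b ^ (ρ₁ / 2) := Real.rpow_lt_rpow (by positivity) hbQ₂ (by positivity)
  -- the window and the flow
  set t₁ : ℝ := τ - b ^ 2 with ht₁def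
  have hb2 : 0 < b ^ 2 := by positivity
  have ht₁τ : t₁ < τ := by rw [ht₁def]; linarith
  have ht₁w : -(3 * b) ^ 2 ≤ t₁ := by rw [ht₁def]; nlinarith
  obtain ⟨X, hX⟩ := hfl τ hτ t₁ ht₁τ lam R₀ hlam hR₀
  rw [← hS] at hX
  -- RESIDENCE ⇒ BANISHMENT at some `s₁`
  have hE3b : ENNReal.ofReal ((3 * b) ^ ρ) * cknE (3 * b) (0 : ℝ × EuclideanSpace ℝ (Fin 3)) H ≤ (c : ℝ≥0∞) :=
    le_trans (le_trans le_add_self le_self_add) (hgauge (3 * b) (by positivity))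
  have hrace : 16 / lam ^ 2 * ((c : ℝ) * (3 * b) ^ (1 - ρ)) < (v / 2) ^ 2 / (32 * (3 * b)) * (τ - t₁) := by
    have hτt : τ - t₁ = b ^ 2 := by rw [ht₁def]; ring
    rw [hτt]
    have h3 := three_b_rpow_le hb1 hρ
    have hc0 : (0 : ℝ) ≤ c := c.2
    have hstep1 : 16 / lam ^ 2 * ((c : ℝ) * (3 * b) ^ (1 - ρ)) ≤ 48 * ((c : ℝ) + 1) * b ^ (1 - ρ₁) / lam ^ 2 := by
      rw [div_mul_eq_mul_div, div_le_div_iff_of_pos_right (by positivity)]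
      have : (c : ℝ) * (3 * b) ^ (1 - ρ) ≤ ((c : ℝ) + 1) * (3 * b ^ (1 - ρ₁)) :=
        mul_le_mul (by linarith) h3 (by positivity) (by positivity)
      nlinarith
    refine lt_of_le_of_lt hstep1 ?_
    have hbsplit : b ^ (1 - ρ₁) = b / b ^ ρ₁ := by
      rw [Real.rpow_sub hb0, Real.rpow_one]
    rw [hbsplit]
    have hbρ : 0 < b ^ ρ₁ := Real.rpow_pos_of_pos hb0 _
    have hkey : 18432 * ((c : ℝ) + 1) < lam ^ 2 * v ^ 2 * b ^ ρ₁ := by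
      have := hQ₁b
      rw [hQ₁def, div_lt_iff₀ (by positivity)] at this
      exact lt_of_lt_of_eq this (mul_comm _ _)
    rw [div_lt_iff₀ (by positivity)]
    rw [show (v / 2) ^ 2 / (32 * (3 * b)) * b ^ 2 * lam ^ 2 = lam ^ 2 * v ^ 2 * b / 384 by
      field_simp; ring]
    rw [lt_div_iff₀ (by norm_num : (0 : ℝ) < 384)]
    calc 48 * ((c : ℝ) + 1) * (b / b ^ ρ₁) * 384 = 18432 * ((c : ℝ) + 1) * b / b ^ ρ₁ := by ring
      _ < lam ^ 2 * v ^ 2 * b ^ ρ₁ * b / b ^ ρ₁ := by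
          rw [div_lt_div_iff_of_pos_right hbρ]
          exact mul_lt_mul_of_pos_right hkey hb0
      _ = lam ^ 2 * v ^ 2 * b := by field_simp
  obtain ⟨s₁, hs₁, hban⟩ := exists_banished hH hcl hb0 hE3b hlam ht₁w hτ.le (fun s hs => (hX.2.2.2.2.1 s hs).1)
    hX.2.2.2.2.2.2.2 hrace
  -- TRAVEL and BOOKKEEPING
  have hSsub' : S ⊆ Metric.closedBall (0 : EuclideanSpace ℝ (Fin 3)) (b / 4) :=
    hSsub.trans (Metric.closedBall_subset_closedBall (by linarith))
  obtain ⟨w, hw, hw1, htrav⟩ := hTrav b hb1 u p hstr lam t₁ τ ht₁τ hτ S hSmeas hSsub' X hX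
  have h1 := htrav s₁ hs₁
  have h2 := hBook u p H c hcls hstr lam hlam hlam1 b hb1 t₁ τ ht₁w hτ.le (by rw [ht₁def]; linarith) S X hX w hw hw1
  have h12 : volume S ≤ volume (X s₁ '' S ∩ Metric.ball (0 : EuclideanSpace ℝ (Fin 3)) (3 * b)) +
      ENNReal.ofReal (Ka / b) * ENNReal.ofReal (Kb * ((c : ℝ) + 1) * b ^ (1 - min ρ 1 / 2) / lam) := by
    calc volume S ≤ _ := h1
      _ ≤ _ := by gcongr
  rw [← ENNReal.ofReal_mul (by positivity)] at h12
  have hsmall : Ka / b * (Kb * ((c : ℝ) + 1) * b ^ (1 - min ρ 1 / 2) / lam) ≤ v / 4 := by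
    rw [← hρ₁def]
    have hbpow : b ^ (1 - ρ₁ / 2) = b / b ^ (ρ₁ / 2) := by rw [Real.rpow_sub hb0, Real.rpow_one]
    rw [hbpow]
    have hpos : 0 < b ^ (ρ₁ / 2) := Real.rpow_pos_of_pos hb0 _
    have hkey : 4 * Ka * Kb * ((c : ℝ) + 1) < lam * v * b ^ (ρ₁ / 2) := by
      have := hQ₂b
      rw [hQ₂def, div_lt_iff₀ (by positivity)] at this
      exact lt_of_lt_of_eq this (mul_comm _ _)
    rw [show Ka / b * (Kb * ((c : ℝ) + 1) * (b / b ^ (ρ₁ / 2)) / lam) = Ka * Kb * ((c : ℝ) + 1) / (lam * b ^ (ρ₁ / 2)) by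
      field_simp]
    rw [div_le_iff₀ (by positivity)]
    nlinarith
  have hlt : volume S < volume S / 2 + ENNReal.ofReal (v / 4) := by
    calc volume S ≤ volume (X s₁ '' S ∩ Metric.ball (0 : EuclideanSpace ℝ (Fin 3)) (3 * b)) +
          ENNReal.ofReal (Ka / b * (Kb * ((c : ℝ) + 1) * b ^ (1 - min ρ 1 / 2) / lam)) := h12
      _ ≤ volume (X s₁ '' S ∩ Metric.ball (0 : EuclideanSpace ℝ (Fin 3)) (3 * b)) + ENNReal.ofReal (v / 4) := by
          gcongr
      _ < volume S / 2 + ENNReal.ofReal (v / 4) := ENNReal.add_lt_add_right ENNReal.ofReal_ne_top hban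
  have hhalf : volume S / 2 ≠ ⊤ := ENNReal.div_ne_top hSfin.ne two_ne_zero
  have hfin2 : volume S / 2 + ENNReal.ofReal (v / 4) ≠ ⊤ := ENNReal.add_ne_top.2 ⟨hhalf, ENNReal.ofReal_ne_top⟩
  have hreal := ENNReal.toReal_strict_mono hfin2 hlt
  rw [ENNReal.toReal_add hhalf ENNReal.ofReal_ne_top, ENNReal.toReal_div, ENNReal.toReal_ofReal (by positivity)] at hreal
  rw [← hvdef] at hreal
  norm_num at hreal
  linarith

end Summit.NavierStokesRegularity.NavierStokesRegularity.Theorems.PowerGaugeEulerLiouville.CasimirHaul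

end
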